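import Summits.HodgeConjecture.HodgeConjecture.Theorems.NikulinTwinTransportTwinExists
import Literature.AlgebraicGeometry.Surfaces.K3HodgeTypesProofs

/-!
# Route NikulinTwinTransport · `TwinExists` (stmt-HodgeConjecture-13677) — the universal twin
# without the named fact `Huybrechts_K3_hodgeTypes_H2`

The landed closing theorem `twinExists_of_marking_periodSurjective_hodgeTypes`
(`NikulinTwinTransportTwinExists.lean`) derives the route decl `TwinExists` from three named facts
of `Literature/AlgebraicGeometry/Surfaces`: markings (`Huybrechts_K3_marking_exists`, Huybrechts
Ch. 1 Prop. 3.5), projective surjectivity of the period map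
(`Huybrechts_K3_periodSurjective_projective`, Ch. 6 Rem. 3.3 / Ch. 7 Thm. 4.1) and the Hodge
types of `H²(K3)` (`Huybrechts_K3_hodgeTypes_H2`, Ch. 6 Prop. 1.2).

The third fact is now a THEOREM modulo the first and the bigrading of the cup product
(`Literature.AlgebraicGeometry.Surfaces.Huybrechts_K3_hodgeTypes_H2_of_marking`,
`K3HodgeTypesProofs.lean`: `H^{0,2} = conj H^{2,0}` unconditionally, `H^{1,1} = σ^⊥ ∩ σ̄^⊥` from
the Hodge decomposition of the model, the vanishing of cup products of non-complementary types and
the Hodge–Riemann inequality read off the marking). Hence: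

* `twinExists_of_marking_periodSurjective_cupPreservesHodgeType` — `TwinExists` from
  `Huybrechts_K3_marking_exists`, `Huybrechts_K3_periodSurjective_projective` and
  `CupPreservesHodgeType 2 S` for K3 surfaces `S` (Voisin I Thm. 5.29 / §7.1.2: the cup product of
  classes of types `(p,q)`, `(p',q')` has type `(p+p',q+q')`);
* `twinExists_of_marking_periodSurjective_deRham` — the same with the bigrading supplied by de
  Rham's theorem in multiplicative form, the named fact
  `Literature.NumberTheory.Transcendental.exists_deRhamIsoFamily` (Warner Thm. 5.36 / 5.45), through
  the tree's `cupPreservesHodgeType_of_exists_deRhamIsoFamily`.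

So the item hinges on the two K3 facts (markings; surjectivity of the period map) and on de Rham's
theorem, a general fact wanted throughout the Hodge programme — no longer on a third K3-specific
fact. Still CONDITIONAL: none of the three is discharged in the tree.
-/

noncomputable section

open scoped Manifold ContDiff
open CategoryTheory
open Literature.AlgebraicGeometry.Motives Literature.AlgebraicGeometry.HodgeTheory
open Literature.AlgebraicGeometry.Surfaces
open Literature.NumberTheory.Transcendental (exists_deRhamIsoFamily)

namespace Summit.HodgeConjecture.HodgeConjecture.Theorems

/-- **The universal twin, granted markings, surjectivity of the period map and the bigrading of
the cup product on K3 surfaces.** The route decl `TwinExists` (every projective K3 surface `S` has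
a projective K3 partner `S'` with integral generators `p, p'` of `H⁴` and a rational,
type-preserving `2`-similitude `ψ : H²(S'(ℂ); ℂ) → H²(S(ℂ); ℂ)`), from
`Huybrechts_K3_marking_exists` (Huybrechts Ch. 1 Prop. 3.5), `Huybrechts_K3_periodSurjective_projective`
(Ch. 6 Rem. 3.3 / Ch. 7 Thm. 4.1) and `CupPreservesHodgeType 2 S` for every K3 surface `S`
(Voisin I Thm. 5.29 / §7.1.2) — the Hodge types of `H²(K3)` being derived from the marking and
the bigrading (`Huybrechts_K3_hodgeTypes_H2_of_marking`).
[cite: Huybrechts2016K3, Ch. 1 Prop. 3.5; Ch. 6 Prop. 1.2 and Rem. 3.3; Ch. 7 Thm. 4.1]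
[cite: VoisinHodgeI2002, §5.3.2 Thm. 5.29 and §7.1.2] -/
theorem twinExists_of_marking_periodSurjective_cupPreservesHodgeType
    (hMk : Huybrechts_K3_marking_exists)
    (hP : Huybrechts_K3_periodSurjective_projective)
    (hcup : ∀ (S : SchemeOver ℂ), IsK3Surface S → CupPreservesHodgeType 2 S) :
    Theses.NikulinTwinTransport.TwinExists :=
  twinExists_of_marking_periodSurjective_hodgeTypes hMk hP
    (Huybrechts_K3_hodgeTypes_H2_of_marking hMk hcup)

/-- **The universal twin, granted markings, surjectivity of the period map and de Rham's theorem**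
(multiplicative form, `exists_deRhamIsoFamily`, on every finite-dimensional complex model space; it
supplies the bigrading of the cup product through `cupPreservesHodgeType_of_exists_deRhamIsoFamily`
and the discharged independence of the Hodge model). The route decl `TwinExists` by name.
[cite: Huybrechts2016K3, Ch. 1 Prop. 3.5; Ch. 6 Prop. 1.2 and Rem. 3.3; Ch. 7 Thm. 4.1]
[cite: WarnerGTM94, Thm. 5.36 / Thm. 5.45] -/
theorem twinExists_of_marking_periodSurjective_deRham
    (hMk : Huybrechts_K3_marking_exists)
    (hP : Huybrechts_K3_periodSurjective_projective)
    (hdR : ∀ (E : Type) [NormedAddCommGroup E] [NormedSpace ℂ E] [FiniteDimensional ℂ E],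
      exists_deRhamIsoFamily 𝓘(ℝ, E)) :
    Theses.NikulinTwinTransport.TwinExists :=
  twinExists_of_marking_periodSurjective_hodgeTypes hMk hP
    (Huybrechts_K3_hodgeTypes_H2_of_marking_of_exists_deRhamIsoFamily hMk hdR)

end Summit.HodgeConjecture.HodgeConjecture.Theorems

end
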